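import Literature.NumberTheory.LFunctions.Xiao2020.ZetaOneTaylorEM
import Literature.NumberTheory.LFunctions.HurwitzEulerMaclaurin
import Mathlib.NumberTheory.LSeries.DirichletContinuation
import Mathlib.NumberTheory.LSeries.Nonvanishing
import HarnessLib

/-!
# Taylor coefficients of `L(s, χ)` at `s = 1` by Euler–Maclaurin and Cauchy's estimate

Topic `Literature/NumberTheory/LFunctions` (sub-namespace `DirichletLTaylor`).  Everything in this
file is PROVED (no named facts).  The companion, for a non-principal Dirichlet character `χ` mod `q`,
of `Xiao2020/ZetaOneTaylorEM.lean` (the case `ζ₁(s) = (s−1)ζ(s)`): rigorous coefficientwise control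
of the power series of the entire function `L(s, χ)` at `s = 1`, which is what a kernel evaluation of
the Taylor data `L^{(i)}(1, χ)/i!`, of the logarithmic derivative `(L′/L)^{(j)}(1, χ)/j!` and hence of
the Dirichlet Li coefficients needs (Johansson: the Euler–Maclaurin formula for `ζ(s, a)` "can be
differentiated termwise with respect to `s`"; here the derivatives are packaged as Taylor
coefficients and the remainder is controlled on a circle by Cauchy's estimate, exactly as in the `ζ`
file).

Writing `s = 1 + w` and `L(s, χ) = q^{−s} Σ_{m mod q} χ(m) ζ(s, m/q)` (Mathlib's definition,
`ZMod.LFunction`; MV §10.1 (10.13)), the order-`ν` Euler–Maclaurin formula for each `ζ(s, m/q)`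
(`hurwitzZeta_eq_eulerMaclaurin_of_re_pos`, with `N` terms per residue class) multiplied by
`w q^{−s}` becomes, residue class by residue class, an EXPONENTIAL POLYNOMIAL in `w`
(`emMainOneProg q m N ν`; `M = Nq + m`):

  `w q^{−s} [main terms of ζ(s, m/q)] = Σ_{n<N} (nq+m)^{−1} w e^{−w log(nq+m)} + q^{−1} e^{−w log M}`
  `   + (2M)^{−1} w e^{−w log M} + Σ_{k ≤ ν} (B_{2k}/(2k)!) q^{2k−1} M^{−2k} w (1+w)(2+w)⋯(2k−1+w) e^{−w log M}`

(`emMainOneProg_eq`), whose Taylor coefficients at `0` are explicit (`emMainOneProgCoeff`,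
`iteratedDeriv_emMainOneProg_zero`); the polar terms `(N + m/q)^{1−s}/(s−1)` lose their pole after the
factor `w` (and `Σ_m χ(m) = 0` is not even needed).  Summing against `χ(m)`:
`w·L(1+w, χ) = P_χ(w) + w·R_χ(w)` (`mul_LFunction_one_add_eq`) with `P_χ = Σ_m χ(m) P_m`
(`emMainOneChar`) and `‖R_χ(w)‖ ≤ q·B` on `|w| = r < 1`, `B = Xiao2020.emTailBound N ν r` the rational
majorant of the `ζ` file (`norm_hurwitzEmRem_le_rat`: the Hurwitz remainder has the SAME majorant).
Cauchy's estimate gives the main results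

* `norm_iteratedDeriv_mul_LFunction_sub_le`: `‖[wⁱ](w·L(1+w,χ)) − [wⁱ]P_χ‖ ≤ r·q·B / rⁱ`;
* `norm_lTaylorCoeff_sub_le`: `‖L^{(i)}(1,χ)/i! − [w^{i+1}]P_χ‖ ≤ r·q·B / r^{i+1}`
  (`[w^{i+1}](w·L(1+w,χ)) = L^{(i)}(1,χ)/i!`, `iteratedDeriv_succ_mul_comp_one_add`);

and, for the logarithmic derivative (Keiper's recursion, as for `ζ₁` in `Xiao2020/KeiperLiTaylor.lean`):

* `sum_lTaylorCoeff_mul_logDerivCoeff`: `Σ_{i≤m} ℓ_i q_{m−i} = (m+1) ℓ_{m+1}` with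
  `ℓ_i = L^{(i)}(1,χ)/i!` (`lTaylorCoeff`), `q_j = (L′/L)^{(j)}(1,χ)/j!` (`logDerivCoeff`), `ℓ_0 = L(1,χ) ≠ 0`.

What is NOT here: any numerics (the interval programs consuming these statements live with their
certificates), and the case `χ = 1` (that is the `ζ₁` file).

## References

* F. Johansson, *Rigorous high-precision computation of the Hurwitz zeta function and its
  derivatives*, Numer. Algorithms 69 (2015) 253–270, §2 (Euler–Maclaurin for `ζ(s,a)` and its
  `s`-derivatives, with rigorous remainder). [Johansson2014]
* H. M. Edwards, *Riemann's Zeta Function*, Academic Press 1974, §6.4 (the formula and the remainder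
  estimate). [Edwards1974]
* H. L. Montgomery, R. C. Vaughan, *Multiplicative Number Theory I*, CUP 2007, §10.1, (10.13)
  (`L(s, χ)` through Hurwitz zeta functions). [MontgomeryVaughan2007]
* J. B. Keiper, *Power series expansions of Riemann's ξ function*, Math. Comp. 58 (1992) 765–773, §2
  (the convolution recursion for the logarithmic derivative). [Keiper1992]
-/

open Complex Finset Filter Topology Metric
open scoped Nat
open Literature.NumberTheory.LFunctions Literature.NumberTheory.LFunctions.Xiao2020

namespace Literature.NumberTheory.LFunctions.DirichletLTaylor

/-! ## The exponential polynomial of one residue class and its Taylor coefficients -/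

/-- `P_m(w)` for the residue class `m mod q` (`N` terms per class, order `ν`, `M = Nq + m`):
`Σ_{n<N} (nq+m)^{−1} w e^{−w log(nq+m)} + q^{−1} e^{−w log M} + (2M)^{−1} w e^{−w log M}
 + Σ_{k≤ν} Σ_l (B_{2k}/(2k)!) q^{2k−1} M^{−2k} pochCoeff(2k−1,l) w^{l+1} e^{−w log M}` — `w` times
`q^{−(1+w)}` times the Euler–Maclaurin main terms of `ζ(1+w, m/q)`. [cite: Johansson2014, §2] -/
noncomputable def emMainOneProg (q m N ν : ℕ) (w : ℂ) : ℂ :=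
  (∑ n ∈ range N, (((n * q + m : ℕ) : ℂ))⁻¹ * (w ^ 1 * cexp (-(Real.log ((n * q + m : ℕ) : ℝ) : ℂ) * w))) +
  ((q : ℂ)⁻¹ * (w ^ 0 * cexp (-(Real.log ((N * q + m : ℕ) : ℝ) : ℂ) * w))) +
  ((2 * ((N * q + m : ℕ) : ℂ))⁻¹ * (w ^ 1 * cexp (-(Real.log ((N * q + m : ℕ) : ℝ) : ℂ) * w))) +
  ∑ p ∈ (Icc 1 ν).sigma (fun k ↦ range (2 * k)),
    ((bernoulli (2 * p.1) : ℂ) / (2 * p.1)! * (q : ℂ) ^ (2 * p.1 - 1) *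
        (((N * q + m : ℕ) : ℂ) ^ (2 * p.1))⁻¹ * (pochCoeff (2 * p.1 - 1) p.2 : ℂ)) *
      (w ^ (p.2 + 1) * cexp (-(Real.log ((N * q + m : ℕ) : ℝ) : ℂ) * w))

/-- `[wⁱ] P_m(w)`. [cite: Johansson2014, §2] -/
noncomputable def emMainOneProgCoeff (q m N ν i : ℕ) : ℂ :=
  (∑ n ∈ range N, (((n * q + m : ℕ) : ℂ))⁻¹ * expMonCoeff 1 (-(Real.log ((n * q + m : ℕ) : ℝ) : ℂ)) i) +
  (q : ℂ)⁻¹ * expMonCoeff 0 (-(Real.log ((N * q + m : ℕ) : ℝ) : ℂ)) i +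
  (2 * ((N * q + m : ℕ) : ℂ))⁻¹ * expMonCoeff 1 (-(Real.log ((N * q + m : ℕ) : ℝ) : ℂ)) i +
  ∑ p ∈ (Icc 1 ν).sigma (fun k ↦ range (2 * k)),
    ((bernoulli (2 * p.1) : ℂ) / (2 * p.1)! * (q : ℂ) ^ (2 * p.1 - 1) *
        (((N * q + m : ℕ) : ℂ) ^ (2 * p.1))⁻¹ * (pochCoeff (2 * p.1 - 1) p.2 : ℂ)) *
      expMonCoeff (p.2 + 1) (-(Real.log ((N * q + m : ℕ) : ℝ) : ℂ)) i

/-- `P_m` is entire (smooth). [folklore] -/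
private theorem contDiff_emMainOneProg (q m N ν : ℕ) {n : WithTop ℕ∞} :
    ContDiff ℂ n (emMainOneProg q m N ν) := by
  unfold emMainOneProg
  refine (((contDiff_sum_expMon _ _ _ _).add (contDiff_const.mul (contDiff_pow_mul_cexp _ _))).add
    (contDiff_const.mul (contDiff_pow_mul_cexp _ _))).add (contDiff_sum_expMon _ _ _ _)

/-- **Taylor coefficients of `P_m` at `0`.** [cite: Johansson2014, §2] -/
theorem iteratedDeriv_emMainOneProg_zero (q m N ν i : ℕ) :
    iteratedDeriv i (emMainOneProg q m N ν) 0 = (i ! : ℂ) * emMainOneProgCoeff q m N ν i := by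
  have hA : ContDiffAt ℂ i (fun w : ℂ ↦ ∑ n ∈ range N,
      (((n * q + m : ℕ) : ℂ))⁻¹ * (w ^ 1 * cexp (-(Real.log ((n * q + m : ℕ) : ℝ) : ℂ) * w))) 0 :=
    (contDiff_sum_expMon _ _ _ _).contDiffAt
  have hB : ContDiffAt ℂ i (fun w : ℂ ↦
      (q : ℂ)⁻¹ * (w ^ 0 * cexp (-(Real.log ((N * q + m : ℕ) : ℝ) : ℂ) * w))) 0 :=
    (contDiff_const.mul (contDiff_pow_mul_cexp _ _)).contDiffAt
  have hC : ContDiffAt ℂ i (fun w : ℂ ↦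
      (2 * ((N * q + m : ℕ) : ℂ))⁻¹ * (w ^ 1 * cexp (-(Real.log ((N * q + m : ℕ) : ℝ) : ℂ) * w))) 0 :=
    (contDiff_const.mul (contDiff_pow_mul_cexp _ _)).contDiffAt
  have hD : ContDiffAt ℂ i (fun w : ℂ ↦ ∑ p ∈ (Icc 1 ν).sigma (fun k ↦ range (2 * k)),
      ((bernoulli (2 * p.1) : ℂ) / (2 * p.1)! * (q : ℂ) ^ (2 * p.1 - 1) *
          (((N * q + m : ℕ) : ℂ) ^ (2 * p.1))⁻¹ * (pochCoeff (2 * p.1 - 1) p.2 : ℂ)) *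
        (w ^ (p.2 + 1) * cexp (-(Real.log ((N * q + m : ℕ) : ℝ) : ℂ) * w))) 0 :=
    (contDiff_sum_expMon _ _ _ _).contDiffAt
  unfold emMainOneProg emMainOneProgCoeff
  rw [iteratedDeriv_fun_add ((hA.add hB).add hC) hD, iteratedDeriv_fun_add (hA.add hB) hC,
    iteratedDeriv_fun_add hA hB, iteratedDeriv_sum_expMon_zero, iteratedDeriv_const_mul_field,
    iteratedDeriv_pow_mul_cexp_zero, iteratedDeriv_const_mul_field, iteratedDeriv_pow_mul_cexp_zero,
    iteratedDeriv_sum_expMon_zero]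
  ring

/-! ## `w q^{−(1+w)} ×` (main terms of `ζ(1+w, m/q)`) `= P_m(w)` -/

/-- Positive-real bases: `q^{−s} · (x/q)^{−t} = q^{t−s} · x^{−t}`. [folklore] -/
private theorem natCast_cpow_mul_div_cpow {q : ℕ} (hq : 0 < q) {x : ℝ} (hx : 0 < x) (s t : ℂ) :
    (q : ℂ) ^ (-s) * (((x / q : ℝ)) : ℂ) ^ (-t) = (q : ℂ) ^ (t - s) * (x : ℂ) ^ (-t) := by
  have hq0 : (q : ℂ) ≠ 0 := by exact_mod_cast hq.ne'
  have hqr : (0 : ℝ) < q := by exact_mod_cast hq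
  have hx0 : (x : ℂ) ≠ 0 := by exact_mod_cast hx.ne'
  have hxq : (((x / q : ℝ)) : ℂ) ≠ 0 := by exact_mod_cast (div_pos hx hqr).ne'
  rw [cpow_def_of_ne_zero hq0, cpow_def_of_ne_zero hxq, cpow_def_of_ne_zero hq0,
    cpow_def_of_ne_zero hx0, ← Complex.exp_add, ← Complex.exp_add]
  congr 1
  rw [← Complex.ofReal_natCast, ← Complex.ofReal_log hqr.le, ← Complex.ofReal_log (div_pos hx hqr).le,
    ← Complex.ofReal_log hx.le, Real.log_div hx.ne' hqr.ne']
  push_cast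
  ring

/-- The shifted parameter: `n + m/q = (nq + m)/q`. [folklore] -/
private theorem natCast_add_div {q : ℕ} (hq : 0 < q) (n m : ℕ) :
    ((n : ℝ) + (m : ℝ) / q) = (((n * q + m : ℕ) : ℝ)) / q := by
  have hqr : (0 : ℝ) < q := by exact_mod_cast hq
  push_cast
  field_simp

/-- **Euler–Maclaurin for one residue class at `s = 1 + w`**: for `1 ≤ m ≤ q`, `N ≥ 1`, `w ≠ 0` and
`Re w > −1`,
`w · q^{−(1+w)} ζ(1+w, m/q) = P_m(w) + w · q^{−(1+w)} R_ν(1+w, m/q)`.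
[cite: Johansson2014, §2] [cite: Edwards1974, §6.4] -/
theorem emMainOneProg_eq {q m N : ℕ} (hq : 0 < q) (hm : 1 ≤ m) (hmq : m ≤ q) (hN : 1 ≤ N) (ν : ℕ)
    {w : ℂ} (hw : w ≠ 0) (hre : 0 < (1 + w).re) :
    w * ((q : ℂ) ^ (-(1 + w)) * HurwitzZeta.hurwitzZeta (((m : ℝ) / q : ℝ) : UnitAddCircle) (1 + w)) =
      emMainOneProg q m N ν w +
        w * ((q : ℂ) ^ (-(1 + w)) * hurwitzEmRem N ν ((m : ℝ) / q) (1 + w)) := by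
  have hqr : (0 : ℝ) < q := by exact_mod_cast hq
  have ha : (0 : ℝ) < (m : ℝ) / q := div_pos (by exact_mod_cast hm) hqr
  have ha1 : (m : ℝ) / q ≤ 1 := by rw [div_le_one hqr]; exact_mod_cast hmq
  have h1 : (1 : ℂ) + w ≠ 1 := fun h ↦ hw (by linear_combination h)
  rw [hurwitzZeta_eq_eulerMaclaurin_of_re_pos hN ha ha1 hre h1 ν]
  have hq0 : (q : ℂ) ≠ 0 := by exact_mod_cast hq.ne'
  set s : ℂ := 1 + w with hs
  -- the residue-class members `nq + m` are positive
  have hpos : ∀ n : ℕ, (0 : ℝ) < ((n * q + m : ℕ) : ℝ) := fun n ↦ by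
    have : 1 ≤ n * q + m := le_add_left hm
    exact_mod_cast this
  have hone : ∀ n : ℕ, 1 ≤ n * q + m := fun n ↦ le_add_left hm
  -- head terms: `w q^{-s} (n + m/q)^{-s} = (nq+m)^{-1} w e^{-w log(nq+m)}`
  have hn : ∀ n ∈ range N, w * ((q : ℂ) ^ (-s) * ((((n : ℝ) + (m : ℝ) / q : ℝ)) : ℂ) ^ (-s)) =
      (((n * q + m : ℕ) : ℂ))⁻¹ * (w ^ 1 * cexp (-(Real.log ((n * q + m : ℕ) : ℝ) : ℂ) * w)) := by
    intro n _
    rw [natCast_add_div hq, natCast_cpow_mul_div_cpow hq (hpos n) s s, sub_self, cpow_zero, one_mul]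
    have := natCast_cpow_neg_natCast_add (n := n * q + m) (hone n) 1 w
    rw [Nat.cast_one, pow_one] at this
    rw [Complex.ofReal_natCast, hs, this]
    ring
  -- the polar term: `w q^{-s} (N + m/q)^{1-s}/(s-1) = q^{-1} e^{-w log M}`
  have hN1 : w * ((q : ℂ) ^ (-s) * (((((N : ℝ) + (m : ℝ) / q : ℝ)) : ℂ) ^ (1 - s) / (s - 1))) =
      (q : ℂ)⁻¹ * (w ^ 0 * cexp (-(Real.log ((N * q + m : ℕ) : ℝ) : ℂ) * w)) := by
    rw [natCast_add_div hq, show (1 : ℂ) - s = -w by rw [hs]; ring,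
      show s - 1 = w by rw [hs]; ring, mul_div_assoc']
    rw [show (q : ℂ) ^ (-s) * ((((((N * q + m : ℕ) : ℝ)) / q : ℝ)) : ℂ) ^ (-w) =
      (q : ℂ) ^ (w - s) * ((((N * q + m : ℕ) : ℝ)) : ℂ) ^ (-w) from natCast_cpow_mul_div_cpow hq (hpos N) s w]
    rw [show w - s = ((-1 : ℤ) : ℂ) by rw [hs]; push_cast; ring, Complex.cpow_intCast, zpow_neg_one]
    have := natCast_cpow_neg_natCast_add (n := N * q + m) (hone N) 0 w
    rw [Nat.cast_zero, pow_zero, zero_add, inv_one, one_mul] at this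
    rw [Complex.ofReal_natCast, this]
    field_simp
  -- the half term
  have hN2 : w * ((q : ℂ) ^ (-s) * (((((N : ℝ) + (m : ℝ) / q : ℝ)) : ℂ) ^ (-s) / 2)) =
      (2 * ((N * q + m : ℕ) : ℂ))⁻¹ * (w ^ 1 * cexp (-(Real.log ((N * q + m : ℕ) : ℝ) : ℂ) * w)) := by
    rw [natCast_add_div hq, mul_div_assoc', natCast_cpow_mul_div_cpow hq (hpos N) s s, sub_self, cpow_zero,
      one_mul]
    have := natCast_cpow_neg_natCast_add (n := N * q + m) (hone N) 1 w
    rw [Nat.cast_one, pow_one] at this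
    rw [Complex.ofReal_natCast, hs, this]
    field_simp
  -- the Bernoulli terms
  have hT : ∀ k ∈ Icc 1 ν, w * ((q : ℂ) ^ (-s) * hurwitzEmTerm N ((m : ℝ) / q) s k) =
      ∑ l ∈ range (2 * k), ((bernoulli (2 * k) : ℂ) / (2 * k)! * (q : ℂ) ^ (2 * k - 1) *
        (((N * q + m : ℕ) : ℂ) ^ (2 * k))⁻¹ * (pochCoeff (2 * k - 1) l : ℂ)) *
          (w ^ (l + 1) * cexp (-(Real.log ((N * q + m : ℕ) : ℝ) : ℂ) * w)) := by
    intro k hk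
    have hk1 : 1 ≤ k := (mem_Icc.1 hk).1
    unfold hurwitzEmTerm
    rw [natCast_add_div hq]
    have hsplit : (q : ℂ) ^ (-s) * ((((((N * q + m : ℕ) : ℝ)) / q : ℝ)) : ℂ) ^ (-(s + ((2 * k - 1 : ℕ) : ℂ))) =
        (q : ℂ) ^ (2 * k - 1) * (((N * q + m : ℕ) : ℂ) ^ (2 * k))⁻¹ *
          cexp (-(Real.log ((N * q + m : ℕ) : ℝ) : ℂ) * w) := by
      rw [natCast_cpow_mul_div_cpow hq (hpos N) s (s + ((2 * k - 1 : ℕ) : ℂ)),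
        show s + ((2 * k - 1 : ℕ) : ℂ) - s = ((2 * k - 1 : ℕ) : ℂ) by ring, Complex.cpow_natCast]
      have hexp : ((((N * q + m : ℕ) : ℝ)) : ℂ) ^ (-(s + ((2 * k - 1 : ℕ) : ℂ))) =
          (((N * q + m : ℕ) : ℂ) ^ (2 * k))⁻¹ * cexp (-(Real.log ((N * q + m : ℕ) : ℝ) : ℂ) * w) := by
        have := natCast_cpow_neg_natCast_add (n := N * q + m) (hone N) (2 * k) w
        rw [Complex.ofReal_natCast, ← this]
        congr 1
        rw [hs, Nat.cast_sub (by omega)]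
        push_cast
        ring
      rw [hexp, mul_assoc]
    have hP := emPoch_one_add w (2 * k - 1)
    rw [show 2 * k - 1 + 1 = 2 * k by omega] at hP
    calc w * ((q : ℂ) ^ (-s) * ((bernoulli (2 * k) : ℂ) / (2 * k)! * emPoch s (2 * k - 1) *
          ((((((N * q + m : ℕ) : ℝ)) / q : ℝ)) : ℂ) ^ (-(s + ((2 * k - 1 : ℕ) : ℂ)))))
        = w * ((bernoulli (2 * k) : ℂ) / (2 * k)! * emPoch s (2 * k - 1) *
            ((q : ℂ) ^ (-s) * ((((((N * q + m : ℕ) : ℝ)) / q : ℝ)) : ℂ) ^ (-(s + ((2 * k - 1 : ℕ) : ℂ))))) := by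
          ring
      _ = _ := by
          rw [hsplit, hs, hP]
          simp_rw [mul_sum, sum_mul, mul_sum]
          refine sum_congr rfl fun l _ ↦ ?_
          ring
  unfold emMainOneProg hurwitzEmMainZero
  simp only [mul_add, mul_sum]
  rw [sum_congr rfl hn, hN1, hN2, sum_congr rfl hT, sum_sigma]

/-! ## `w·L(1+w, χ) = P_χ(w) + w·R_χ(w)` -/

variable {q : ℕ} [NeZero q]

/-- `P_χ(w) = Σ_{m<q} χ(m) P_m(w)`: `w` times the Euler–Maclaurin main terms of `L(1+w, χ)`.
[cite: Johansson2014, §2] [cite: MontgomeryVaughan2007, §10.1 (10.13)] -/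
noncomputable def emMainOneChar (N ν : ℕ) (χ : DirichletCharacter ℂ q) (w : ℂ) : ℂ :=
  ∑ m ∈ range q, χ (m : ZMod q) * emMainOneProg q m N ν w

/-- `[wⁱ] P_χ(w) = Σ_{m<q} χ(m) [wⁱ] P_m(w)`. [cite: Johansson2014, §2] -/
noncomputable def emMainOneCharCoeff (N ν : ℕ) (χ : DirichletCharacter ℂ q) (i : ℕ) : ℂ :=
  ∑ m ∈ range q, χ (m : ZMod q) * emMainOneProgCoeff q m N ν i

/-- The remainder `R_χ(w) = Σ_{m<q} χ(m) q^{−(1+w)} R_ν(1+w, m/q)`. [cite: Johansson2014, §2] -/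
noncomputable def charEmRem (N ν : ℕ) (χ : DirichletCharacter ℂ q) (w : ℂ) : ℂ :=
  ∑ m ∈ range q, χ (m : ZMod q) * ((q : ℂ) ^ (-(1 + w)) * hurwitzEmRem N ν ((m : ℝ) / q) (1 + w))

omit [NeZero q] in
/-- `P_χ` is entire (smooth). [folklore] -/
private theorem contDiff_emMainOneChar (N ν : ℕ) (χ : DirichletCharacter ℂ q) {n : WithTop ℕ∞} :
    ContDiff ℂ n (emMainOneChar N ν χ) := by
  unfold emMainOneChar
  exact ContDiff.sum fun m _ ↦ contDiff_const.mul (contDiff_emMainOneProg q m N ν)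

omit [NeZero q] in
/-- **Taylor coefficients of `P_χ` at `0`.** [cite: Johansson2014, §2] -/
theorem iteratedDeriv_emMainOneChar_zero (N ν : ℕ) (χ : DirichletCharacter ℂ q) (i : ℕ) :
    iteratedDeriv i (emMainOneChar N ν χ) 0 = (i ! : ℂ) * emMainOneCharCoeff N ν χ i := by
  unfold emMainOneChar emMainOneCharCoeff
  rw [iteratedDeriv_fun_sum (fun m _ ↦ (contDiff_const.mul (contDiff_emMainOneProg q m N ν)).contDiffAt),
    mul_sum]
  refine sum_congr rfl fun m _ ↦ ?_
  rw [iteratedDeriv_const_mul_field, iteratedDeriv_emMainOneProg_zero]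
  ring

/-- A sum over `ZMod q` as a sum over the representatives `0, …, q−1`. [folklore] -/
private theorem sum_zmod_eq_sum_range (F : ZMod q → ℂ) :
    ∑ j : ZMod q, F j = ∑ m ∈ range q, F (m : ZMod q) := by
  refine Finset.sum_nbij (fun j : ZMod q ↦ j.val) (fun j _ ↦ mem_range.2 (ZMod.val_lt j))
    (fun a _ b _ h ↦ ZMod.val_injective q h) (fun m hm ↦ ?_) (fun j _ ↦ by rw [ZMod.natCast_zmod_val])
  refine ⟨(m : ZMod q), by simp, ?_⟩
  exact ZMod.val_natCast_of_lt (mem_range.1 (Finset.mem_coe.1 hm))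

/-- **Euler–Maclaurin for `L(s, χ)` at `s = 1 + w`** (`χ ≠ 1`, `N ≥ 1`, `w ≠ 0`, `Re w > −1`):
`w·L(1+w, χ) = P_χ(w) + w·R_χ(w)`. [cite: Johansson2014, §2] [cite: MontgomeryVaughan2007, §10.1 (10.13)] -/
theorem mul_LFunction_one_add_eq {χ : DirichletCharacter ℂ q} (hχ : χ ≠ 1) {N : ℕ} (hN : 1 ≤ N) (ν : ℕ)
    {w : ℂ} (hw : w ≠ 0) (hre : 0 < (1 + w).re) :
    w * χ.LFunction (1 + w) = emMainOneChar N ν χ w + w * charEmRem N ν χ w := by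
  have hq1 : q ≠ 1 := by
    rintro rfl
    exact hχ (Subsingleton.elim _ _)
  have hq : 0 < q := Nat.pos_of_ne_zero (NeZero.ne q)
  have hq2 : 1 < q := lt_of_le_of_ne hq (Ne.symm hq1)
  haveI : Fact (1 < q) := ⟨hq2⟩
  have hχ0 : χ (0 : ZMod q) = 0 := MulChar.map_zero χ
  rw [DirichletCharacter.LFunction, ZMod.LFunction, sum_zmod_eq_sum_range]
  -- residue `0` contributes nothing on either side; residues `1 ≤ m < q` by `emMainOneProg_eq`
  have hterm : ∀ m ∈ range q, w * ((q : ℂ) ^ (-(1 + w)) *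
      (χ (m : ZMod q) * HurwitzZeta.hurwitzZeta (ZMod.toAddCircle (m : ZMod q)) (1 + w))) =
      χ (m : ZMod q) * emMainOneProg q m N ν w +
        w * (χ (m : ZMod q) * ((q : ℂ) ^ (-(1 + w)) * hurwitzEmRem N ν ((m : ℝ) / q) (1 + w))) := by
    intro m hm
    have hmq : m < q := mem_range.1 hm
    rcases Nat.eq_zero_or_pos m with rfl | hm1
    · simp [hχ0]
    · have hval : ZMod.toAddCircle (m : ZMod q) = (((m : ℝ) / q : ℝ) : UnitAddCircle) := by
        rw [ZMod.toAddCircle_apply, ZMod.val_natCast_of_lt hmq]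
      rw [hval]
      have key := emMainOneProg_eq hq hm1 hmq.le hN ν hw hre
      calc w * ((q : ℂ) ^ (-(1 + w)) * (χ (m : ZMod q) *
            HurwitzZeta.hurwitzZeta (((m : ℝ) / q : ℝ) : UnitAddCircle) (1 + w)))
          = χ (m : ZMod q) * (w * ((q : ℂ) ^ (-(1 + w)) *
              HurwitzZeta.hurwitzZeta (((m : ℝ) / q : ℝ) : UnitAddCircle) (1 + w))) := by ring
        _ = _ := by rw [key]; ring
  unfold emMainOneChar charEmRem
  rw [mul_sum, mul_sum, sum_congr rfl hterm, sum_add_distrib, ← mul_sum]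

/-! ## The Cauchy estimate -/

/-- On the circle `|w| = r` (`0 < r < 1`): `‖w·L(1+w,χ) − P_χ(w)‖ ≤ r·q·B`, `B = emTailBound N ν r`.
[cite: Johansson2014, §2] [cite: Edwards1974, §6.4] -/
theorem norm_mul_LFunction_sub_emMainOneChar_le {χ : DirichletCharacter ℂ q} (hχ : χ ≠ 1) {N ν : ℕ}
    (hN : 1 ≤ N) (hν : ν ≠ 0) {r : ℝ} (hr0 : 0 < r) (hr1 : r < 1) {w : ℂ} (hw : ‖w‖ = r) :
    ‖w * χ.LFunction (1 + w) - emMainOneChar N ν χ w‖ ≤ r * (q * emTailBound N ν r) := by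
  have hw0 : w ≠ 0 := fun h ↦ by rw [h, norm_zero] at hw; exact hr0.ne' hw.symm
  have hwre : |w.re| < 1 := lt_of_le_of_lt (abs_re_le_norm w) (by rw [hw]; exact hr1)
  have hre : 0 < (1 + w).re := by
    rw [add_re, one_re]
    linarith [neg_abs_le w.re]
  have hq : 0 < q := Nat.pos_of_ne_zero (NeZero.ne q)
  have hqr : (0 : ℝ) < q := by exact_mod_cast hq
  rw [mul_LFunction_one_add_eq hχ hN ν hw0 hre, add_sub_cancel_left, norm_mul, hw]
  refine mul_le_mul_of_nonneg_left ?_ hr0.le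
  -- `‖q^{-(1+w)}‖ ≤ 1`
  have hqpow : ‖(q : ℂ) ^ (-(1 + w))‖ ≤ 1 := by
    rw [Complex.norm_natCast_cpow_of_pos hq]
    refine Real.rpow_le_one_of_one_le_of_nonpos (by exact_mod_cast hq) ?_
    simp only [neg_re, add_re, one_re]
    linarith [neg_abs_le w.re]
  have hB0 : 0 ≤ emTailBound N ν r := emTailBound_nonneg N ν hr0.le
  -- each residue class contributes at most `B`
  have hterm : ∀ m ∈ range q, ‖χ (m : ZMod q) * ((q : ℂ) ^ (-(1 + w)) *
      hurwitzEmRem N ν ((m : ℝ) / q) (1 + w))‖ ≤ emTailBound N ν r := by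
    intro m hm
    rcases Nat.eq_zero_or_pos m with rfl | hm1
    · have hq1 : q ≠ 1 := by
        rintro rfl
        exact hχ (Subsingleton.elim _ _)
      haveI : Fact (1 < q) := ⟨lt_of_le_of_ne hq (Ne.symm hq1)⟩
      rw [Nat.cast_zero, MulChar.map_zero χ, zero_mul, norm_zero]
      exact hB0
    · have ha : (0 : ℝ) < (m : ℝ) / q := div_pos (by exact_mod_cast hm1) hqr
      have hR := norm_hurwitzEmRem_le_rat hN ha hre hν
      have hP := norm_emPoch_one_add_le hw.le (2 * ν + 1)
      have hN0 : (0 : ℝ) < N := by exact_mod_cast hN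
      rw [norm_mul, norm_mul]
      calc ‖χ (m : ZMod q)‖ * (‖(q : ℂ) ^ (-(1 + w))‖ * ‖hurwitzEmRem N ν ((m : ℝ) / q) (1 + w)‖)
          ≤ 1 * (1 * ‖hurwitzEmRem N ν ((m : ℝ) / q) (1 + w)‖) :=
            mul_le_mul (DirichletCharacter.norm_le_one χ _)
              (mul_le_mul_of_nonneg_right hqpow (norm_nonneg _))
              (mul_nonneg (norm_nonneg _) (norm_nonneg _)) zero_le_one
        _ = ‖hurwitzEmRem N ν ((m : ℝ) / q) (1 + w)‖ := by ring
        _ ≤ emTailBound N ν r := by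
            refine hR.trans ?_
            unfold emTailBound
            gcongr
  unfold charEmRem
  calc ‖∑ m ∈ range q, χ (m : ZMod q) * ((q : ℂ) ^ (-(1 + w)) * hurwitzEmRem N ν ((m : ℝ) / q) (1 + w))‖
      ≤ ∑ m ∈ range q, ‖χ (m : ZMod q) * ((q : ℂ) ^ (-(1 + w)) * hurwitzEmRem N ν ((m : ℝ) / q) (1 + w))‖ :=
        norm_sum_le (range q) _
    _ ≤ ∑ _m ∈ range q, emTailBound N ν r := sum_le_sum hterm
    _ = q * emTailBound N ν r := by rw [sum_const, card_range, nsmul_eq_mul]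

/-- **Main result: enclosure of the Taylor coefficients of `w·L(1+w, χ)` at `0`.** For `χ ≠ 1`,
`N ≥ 1`, `ν ≥ 1`, `0 < r < 1` and every `i`:
`‖(w·L(1+w,χ))^{(i)}(0)/i! − [wⁱ]P_χ‖ ≤ r·q·B / rⁱ`. [cite: Johansson2014, §2] [cite: Edwards1974, §6.4] -/
theorem norm_iteratedDeriv_mul_LFunction_sub_le {χ : DirichletCharacter ℂ q} (hχ : χ ≠ 1) {N ν : ℕ}
    (hN : 1 ≤ N) (hν : ν ≠ 0) {r : ℝ} (hr0 : 0 < r) (hr1 : r < 1) (i : ℕ) :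
    ‖iteratedDeriv i (fun w ↦ w * χ.LFunction (1 + w)) 0 / (i ! : ℂ) - emMainOneCharCoeff N ν χ i‖ ≤
      r * (q * emTailBound N ν r) / r ^ i := by
  set E : ℂ → ℂ := fun w ↦ w * χ.LFunction (1 + w) - emMainOneChar N ν χ w with hE
  have hL : Differentiable ℂ (fun w : ℂ ↦ w * χ.LFunction (1 + w)) :=
    differentiable_id.mul ((DirichletCharacter.differentiable_LFunction hχ).comp
      ((differentiable_const _).add differentiable_id))
  have hZ : ContDiff ℂ i (fun w : ℂ ↦ w * χ.LFunction (1 + w)) := hL.contDiff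
  have hEdiff : Differentiable ℂ E := hL.sub (contDiff_emMainOneChar N ν χ (n := 1)).differentiable_one
  have hDE : iteratedDeriv i E 0 =
      iteratedDeriv i (fun w ↦ w * χ.LFunction (1 + w)) 0 - (i ! : ℂ) * emMainOneCharCoeff N ν χ i := by
    rw [hE, iteratedDeriv_fun_sub hZ.contDiffAt (contDiff_emMainOneChar N ν χ).contDiffAt,
      iteratedDeriv_emMainOneChar_zero]
  have hC := Complex.norm_iteratedDeriv_le_of_forall_mem_sphere_norm_le (f := E) (c := 0) i hr0
    hEdiff.diffContOnCl (fun z hz ↦ norm_mul_LFunction_sub_emMainOneChar_le hχ hN hν hr0 hr1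
      (by simpa using hz))
  rw [hDE] at hC
  have hfi : (0 : ℝ) < i ! := by exact_mod_cast Nat.factorial_pos i
  have hfi' : (i ! : ℂ) ≠ 0 := by exact_mod_cast Nat.factorial_ne_zero i
  have : iteratedDeriv i (fun w ↦ w * χ.LFunction (1 + w)) 0 / (i ! : ℂ) - emMainOneCharCoeff N ν χ i =
      (iteratedDeriv i (fun w ↦ w * χ.LFunction (1 + w)) 0 - (i ! : ℂ) * emMainOneCharCoeff N ν χ i) /
        (i ! : ℂ) := by
    field_simp
  rw [this, norm_div, Complex.norm_natCast, div_le_iff₀ hfi]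
  calc ‖iteratedDeriv i (fun w ↦ w * χ.LFunction (1 + w)) 0 - (i ! : ℂ) * emMainOneCharCoeff N ν χ i‖
      ≤ i ! * (r * (q * emTailBound N ν r)) / r ^ i := hC
    _ = r * (q * emTailBound N ν r) / r ^ i * i ! := by ring

/-! ## The Taylor coefficients of `L(s, χ)` and of `L′/L(s, χ)` at `s = 1` -/

/-- `ℓ_i(χ) = L^{(i)}(1, χ)/i!`, the Taylor coefficients of `L(s, χ)` at `s = 1`
(`ℓ_0 = L(1, χ) ≠ 0` for `χ ≠ 1`). [cite: Johansson2014, §2] -/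
noncomputable def lTaylorCoeff (χ : DirichletCharacter ℂ q) (i : ℕ) : ℂ :=
  iteratedDeriv i χ.LFunction 1 / (i ! : ℂ)

/-- `q_j(χ) = (L′/L)^{(j)}(1, χ)/j!`, the Taylor coefficients of the logarithmic derivative of
`L(s, χ)` at `s = 1`. [cite: Keiper1992, §2] -/
noncomputable def logDerivCoeff (χ : DirichletCharacter ℂ q) (j : ℕ) : ℂ :=
  iteratedDeriv j (logDeriv χ.LFunction) 1 / (j ! : ℂ)

/-- `[w^{i+1}](w·f(1+w)) = f^{(i)}(1)/i!` (Leibniz with the factor `w`). [folklore] -/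
private theorem iteratedDeriv_succ_mul_comp_one_add {f : ℂ → ℂ} (hf : Differentiable ℂ f) (i : ℕ) :
    iteratedDeriv (i + 1) (fun w ↦ w * f (1 + w)) 0 = ((i : ℂ) + 1) * iteratedDeriv i f 1 := by
  have hg : ContDiffAt ℂ (↑(i + 1)) (fun w : ℂ ↦ f (1 + w)) 0 :=
    (hf.contDiff.comp (contDiff_const.add contDiff_id)).contDiffAt
  have hid : ContDiffAt ℂ (↑(i + 1)) (fun w : ℂ ↦ w) 0 := contDiffAt_id
  rw [iteratedDeriv_fun_mul hid hg]
  simp_rw [iteratedDeriv_fun_id_zero]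
  simp only [mul_ite, mul_one, mul_zero, ite_mul, zero_mul, sum_ite_eq', mem_range]
  rw [if_pos (by omega), Nat.choose_one_right, Nat.add_sub_cancel, iteratedDeriv_comp_const_add i f 1]
  simp

/-- **Enclosure of the Taylor coefficients of `L(s, χ)` at `1`**: for `χ ≠ 1`, `N ≥ 1`, `ν ≥ 1`,
`0 < r < 1` and every `i`, `‖ℓ_i(χ) − [w^{i+1}]P_χ‖ ≤ r·q·B / r^{i+1}`.
[cite: Johansson2014, §2] [cite: Edwards1974, §6.4] -/
theorem norm_lTaylorCoeff_sub_le {χ : DirichletCharacter ℂ q} (hχ : χ ≠ 1) {N ν : ℕ} (hN : 1 ≤ N)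
    (hν : ν ≠ 0) {r : ℝ} (hr0 : 0 < r) (hr1 : r < 1) (i : ℕ) :
    ‖lTaylorCoeff χ i - emMainOneCharCoeff N ν χ (i + 1)‖ ≤ r * (q * emTailBound N ν r) / r ^ (i + 1) := by
  have h := norm_iteratedDeriv_mul_LFunction_sub_le hχ hN hν hr0 hr1 (i + 1)
  rw [iteratedDeriv_succ_mul_comp_one_add (DirichletCharacter.differentiable_LFunction hχ)] at h
  have hi : ((i : ℂ) + 1) ≠ 0 := by exact_mod_cast Nat.succ_ne_zero i
  have hfi : (i ! : ℂ) ≠ 0 := by exact_mod_cast Nat.factorial_ne_zero i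
  have e : ((i : ℂ) + 1) * iteratedDeriv i χ.LFunction 1 / ((i + 1)! : ℂ) = lTaylorCoeff χ i := by
    unfold lTaylorCoeff
    rw [Nat.factorial_succ]
    push_cast
    field_simp
  rwa [e] at h

/-- `ℓ_0(χ) = L(1, χ)`. [cite: Johansson2014, §2] -/
theorem lTaylorCoeff_zero (χ : DirichletCharacter ℂ q) : lTaylorCoeff χ 0 = χ.LFunction 1 := by
  simp [lTaylorCoeff]

/-- `L(s, χ) ≠ 0` near `s = 1` (`χ ≠ 1`). [folklore] -/
private theorem LFunction_ne_zero_near_one {χ : DirichletCharacter ℂ q} (hχ : χ ≠ 1) :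
    ∀ᶠ s in 𝓝 (1 : ℂ), χ.LFunction s ≠ 0 :=
  (DirichletCharacter.differentiable_LFunction hχ 1).continuousAt.eventually_ne
    (DirichletCharacter.LFunction_apply_one_ne_zero hχ)

/-- `L′/L(s, χ)` is analytic at `s = 1` (`χ ≠ 1`: `L(1, χ) ≠ 0`). [cite: Keiper1992, §2] -/
theorem analyticAt_logDeriv_LFunction_one {χ : DirichletCharacter ℂ q} (hχ : χ ≠ 1) :
    AnalyticAt ℂ (logDeriv χ.LFunction) 1 := by
  have ha : AnalyticAt ℂ χ.LFunction 1 := (DirichletCharacter.differentiable_LFunction hχ).analyticAt 1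
  show AnalyticAt ℂ (fun z ↦ deriv χ.LFunction z / χ.LFunction z) 1
  exact ha.deriv.div ha (DirichletCharacter.LFunction_apply_one_ne_zero hχ)

/-- **Leibniz on `L · (L′/L) = L′` at `s = 1`**: `Σ_{i≤m} ℓ_i q_{m−i} = (m+1) ℓ_{m+1}` — the
recursion determining the `q_m(χ)` from the `ℓ_i(χ)` (`ℓ_0 = L(1,χ) ≠ 0`). [cite: Keiper1992, §2] -/
theorem sum_lTaylorCoeff_mul_logDerivCoeff {χ : DirichletCharacter ℂ q} (hχ : χ ≠ 1) (m : ℕ) :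
    ∑ i ∈ range (m + 1), lTaylorCoeff χ i * logDerivCoeff χ (m - i) =
      ((m : ℂ) + 1) * lTaylorCoeff χ (m + 1) := by
  have hdiff := DirichletCharacter.differentiable_LFunction hχ
  have hev : (fun z ↦ χ.LFunction z * logDeriv χ.LFunction z) =ᶠ[𝓝 (1 : ℂ)]
      deriv χ.LFunction := by
    filter_upwards [LFunction_ne_zero_near_one hχ] with z hz
    rw [logDeriv_apply]
    field_simp
  have hkey : iteratedDeriv m (fun z ↦ χ.LFunction z * logDeriv χ.LFunction z) 1 =
      iteratedDeriv (m + 1) χ.LFunction 1 := by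
    rw [hev.iteratedDeriv_eq, iteratedDeriv_succ']
  rw [iteratedDeriv_fun_mul (hdiff.contDiff.contDiffAt)
    (analyticAt_logDeriv_LFunction_one hχ).contDiffAt] at hkey
  have hu : ∀ i, iteratedDeriv i χ.LFunction 1 = (i ! : ℂ) * lTaylorCoeff χ i := fun i ↦ by
    have hi : (i ! : ℂ) ≠ 0 := by exact_mod_cast Nat.factorial_ne_zero _
    unfold lTaylorCoeff
    field_simp
  have hq : ∀ i, iteratedDeriv i (logDeriv χ.LFunction) 1 =
      (i ! : ℂ) * logDerivCoeff χ i := fun i ↦ by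
    have hi : (i ! : ℂ) ≠ 0 := by exact_mod_cast Nat.factorial_ne_zero _
    unfold logDerivCoeff
    field_simp
  simp_rw [hu, hq] at hkey
  have hsum : ∑ i ∈ range (m + 1), (m.choose i : ℂ) * ((i ! : ℂ) * lTaylorCoeff χ i) *
        (((m - i)! : ℂ) * logDerivCoeff χ (m - i)) =
      (m ! : ℂ) * ∑ i ∈ range (m + 1), lTaylorCoeff χ i * logDerivCoeff χ (m - i) := by
    rw [mul_sum]
    refine sum_congr rfl fun i hi ↦ ?_
    have := Nat.choose_mul_factorial_mul_factorial (Nat.lt_succ_iff.mp (mem_range.mp hi))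
    rw [← this]
    push_cast
    ring
  rw [hsum, Nat.factorial_succ] at hkey
  push_cast at hkey
  have hfm : (m ! : ℂ) ≠ 0 := by exact_mod_cast Nat.factorial_ne_zero _
  apply mul_left_cancel₀ hfm
  linear_combination hkey

end Literature.NumberTheory.LFunctions.DirichletLTaylor
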